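import Summits.ValiantsHypothesis.ValiantsHypothesis.Theorems.BarrierLeverAnchoredDoorHitsLowerPairsP2Reduction

/-!
# Support item `AnchoredDoorHitsLowerPairs` (stmt-ValiantsHypothesis-22510), line `anchored-peeling`:
# THE TAIL-GRADED (POTENTIAL-SHIFTED) DOMINANT REDUCTION K1′ — orientation-free, at every profile

Helper file (`--supports stmt-ValiantsHypothesis-22510`; cell valiant-natproofs, rung V4; prover seat val-np-p1 gen 26; memo
HOME/val-np-p1/g26/MEMO-conjZ-node-valnp1-g26.md §13). Closes NO item.

WHAT. The profile-2 reduction K1 (`P2.symbolicDet_two_ne_zero_of_p2Entry`, p692620) kills the `y`-tails (`ψ ↦ 0`) and is therefore dead exactly when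
profile-2 nested Hall fails (too many wide columns for the deep rows); the orientation problem of Conjecture Z (memo §1) comes from there. Here the
`y`-tails are KEPT and GRADED: evaluate the symbolic witness at the `ℂ[T]`-point `θ_α ↦ Θ α`, `φ_{α b} ↦ Φ α b`, `ψ_{α d} ↦ Ψ α d · T`
(`ptPoint`). By the anchor-set expansion (`AnchorSets.coeff_symbolicWitness_eq_sum`, closed forms `xcoeff_eq` / `ycoeff_eq`) the layout entry
`[x^U y^W]` becomes `Σ_J Θ^J · xcE Φ U J · ycE Ψ W J · T^{nTails W J}` (`aeval_ptPoint_entry`), `nTails W J = |W ∖ yFoot J|` = the number of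
`y`-tails; a contributing `J` has `|J| ≤ |U|` and `|yFoot J| ≤ s |J|`, so the entry has NO `T`-coefficient below `|W| − s|U|`
(`ptEntry_eq_zero_of_lt`). For POTENTIALS `a : rows → ℕ` and DISCOUNTS `c : columns → ℕ` (integer column potentials `−c j`) with `a i − c j + s |u i| ≤ |w j|` whenever `a i > c j`, the
bottom-coefficient lemma for determinants (`coeff_det_of_potential`: if every entry `M i j ∈ ℂ[T]` has no coefficient below `a i + b j` then
`[T^{Σa+Σb}] det M = det ([T^{a i + b j}] M i j)`) gives:

**THEOREM `symbolicDet_ne_zero_of_ptEntry` (K1′).** If `det ([c j ≤ a i] · ptEntry s (a i − c j) Θ Φ Ψ (w j) (u i))_{i j} ≠ 0` for some complex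
`Θ Φ Ψ` and admissible `a, c` (after scaling column `j` by `T^{c j}`), then `symbolicDet s h r u w ≠ 0`; `symbolicDet_ne_zero_of_ptEntry_nonneg` is the
version with non-negative potentials on both sides, `symbolicDet_ne_zero_of_ptEntry_zero` the tail-free case.

`a = c = 0` at `s = 2` is (a tail-free form of) K1; with potentials the reduction applies to EVERY pair — e.g. for the doubly non-nested-Hall pair
(Δ⁶ ⊔ 104 points, tB(11,3)), r = 232, the potentials `a = 1` on singleton rows and discounts `c = 1` on columns of size `≤ 2` make the tail-graded
dominant determinant nonzero (lab/k1prime.py; kit j327370: 938 + 1 pairs, nonzero in every orientation tested, including all 228 orientations where K1 is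
dead). Bookkeeping `def`s only: `ptPoint`, `ycE`, `nTails`, `ptEntry`.

WHAT THIS IS NOT: no pair is certified here; nothing on crux stmt-ValiantsHypothesis-14610 or on `VP` versus `VNP`.
-/

set_option linter.dupNamespace false

namespace Summit.ValiantsHypothesis.ValiantsHypothesis.Theorems.BarrierLever.AnchoredPeeling

open Finset MvPolynomial
open Summit.ValiantsHypothesis.ValiantsHypothesis.Theorems.BarrierLever.BrickCalculus (pexpo pexpo_def)

noncomputable section

namespace PT

variable {h : ℕ}

/-! ## 1. Bottom coefficients of products and determinants under potentials (pure polynomial algebra) -/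

section Bottom

variable {R : Type*} [CommRing R]

/-- If each `p i` (`i ∈ S`) has no coefficient below `v i`, then the product has no coefficient below `Σ v` and its coefficient at `Σ v` is the
product of the coefficients at the `v i`. -/
theorem coeff_prod_of_vanish {ι : Type*} [DecidableEq ι] (p : ι → Polynomial R) (v : ι → ℕ) (S : Finset ι)
    (hv : ∀ i ∈ S, ∀ k < v i, (p i).coeff k = 0) :
    (∏ i ∈ S, p i).coeff (∑ i ∈ S, v i) = ∏ i ∈ S, (p i).coeff (v i) ∧ ∀ k < ∑ i ∈ S, v i, (∏ i ∈ S, p i).coeff k = 0 := by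
  induction S using Finset.induction_on with
  | empty => simp
  | @insert a S ha ih =>
    have hva : ∀ k < v a, (p a).coeff k = 0 := hv a (mem_insert_self a S)
    obtain ⟨ih1, ih2⟩ := ih (fun i hi => hv i (mem_insert_of_mem hi))
    rw [prod_insert ha, sum_insert ha, prod_insert ha]
    have key : ∀ n, (p a * ∏ i ∈ S, p i).coeff n = ∑ x ∈ antidiagonal n, (p a).coeff x.1 * (∏ i ∈ S, p i).coeff x.2 :=
      fun n => Polynomial.coeff_mul _ _ n
    constructor
    · rw [key, Finset.sum_eq_single (v a, ∑ i ∈ S, v i)]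
      · rw [ih1]
      · intro x hx hne
        rw [HasAntidiagonal.mem_antidiagonal] at hx
        rcases lt_or_ge x.1 (v a) with h1 | h1
        · rw [hva _ h1, zero_mul]
        · have h2 : x.2 ≤ ∑ i ∈ S, v i := by omega
          rcases h2.lt_or_eq with h2 | h2
          · rw [ih2 _ h2, mul_zero]
          · exfalso; apply hne; ext <;> simp <;> omega
      · intro hn; exact absurd (HasAntidiagonal.mem_antidiagonal.mpr (by simp)) hn
    · intro k hk
      rw [key]
      refine Finset.sum_eq_zero (fun x hx => ?_)
      rw [HasAntidiagonal.mem_antidiagonal] at hx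
      rcases lt_or_ge x.1 (v a) with h1 | h1
      · rw [hva _ h1, zero_mul]
      · have h2 : x.2 < ∑ i ∈ S, v i := by omega
        rw [ih2 _ h2, mul_zero]

/-- **Bottom coefficient of a determinant under potentials.** If every entry `M i j` has no coefficient below `a i + b j`, then the coefficient of
`det M` at `Σ a + Σ b` is the determinant of the `(a i + b j)`-th coefficients. -/
theorem coeff_det_of_potential {n : ℕ} (M : Matrix (Fin n) (Fin n) (Polynomial R)) (a b : Fin n → ℕ)
    (hM : ∀ i j, ∀ k < a i + b j, (M i j).coeff k = 0) :
    (M.det).coeff (∑ i, a i + ∑ j, b j) = (Matrix.of fun i j => (M i j).coeff (a i + b j)).det := by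
  rw [Matrix.det_apply, Matrix.det_apply, Polynomial.finsetSum_coeff]
  refine Finset.sum_congr rfl (fun σ _ => ?_)
  have hperm : ∑ i, a (σ i) = ∑ i, a i := Equiv.sum_comp σ a
  have hsum : ∑ i, a i + ∑ j, b j = ∑ i, (a (σ i) + b i) := by
    rw [sum_add_distrib, hperm]
  rw [Polynomial.coeff_smul, hsum,
    (coeff_prod_of_vanish (fun i => M (σ i) i) (fun i => a (σ i) + b i) univ (fun i _ k hk => hM (σ i) i k hk)).1]
  rfl

end Bottom

/-! ## 2. The tail-graded point over `ℂ[T]` and the evaluated one-sided coefficients -/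

section Point

/-- **The tail-graded point over `ℂ[T]`:** anchor weights `Θ α`, `x`-tails `Φ α b`, `y`-tails `Ψ α d · T`. -/
def ptPoint (Θ : Finset (Fin h) × Finset (Fin h) → ℂ) (Φ Ψ : Finset (Fin h) × Finset (Fin h) → Fin h → ℂ) : Param h → Polynomial ℂ
  | Sum.inl α => Polynomial.C (Θ α)
  | Sum.inr (Sum.inl q) => Polynomial.C (Φ q.1 q.2)
  | Sum.inr (Sum.inr q) => Polynomial.C (Ψ q.1 q.2) * Polynomial.X

open Classical in
/-- The evaluated one-sided `y`-coefficient of an anchor set on the column `W` with `y`-tail weights `Ψ` (closed form of `AnchorSets.ycoeff_eq`). -/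
def ycE (Ψ : Finset (Fin h) × Finset (Fin h) → Fin h → ℂ) (W : Finset (Fin h)) (J : Finset (Finset (Fin h) × Finset (Fin h))) : ℂ :=
  if (J : Set (Finset (Fin h) × Finset (Fin h))).PairwiseDisjoint Prod.snd ∧ AnchorSets.yFoot J ⊆ W
  then ∏ d ∈ W \ AnchorSets.yFoot J, ∑ α ∈ J, Ψ α d else 0

/-- The number of `y`-tails of the anchor set `J` on the column `W`. -/
def nTails (W : Finset (Fin h)) (J : Finset (Finset (Fin h) × Finset (Fin h))) : ℕ := (W \ AnchorSets.yFoot J).card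

open Classical in
/-- **The tail-graded dominant entry at tail count `q`:** `Σ_{J ⊆ anchors s h, nTails W J = q} Θ^J · xcE Φ U J · ycE Ψ W J`. -/
def ptEntry (s q : ℕ) (Θ : Finset (Fin h) × Finset (Fin h) → ℂ) (Φ Ψ : Finset (Fin h) × Finset (Fin h) → Fin h → ℂ)
    (W U : Finset (Fin h)) : ℂ :=
  ∑ J ∈ ((anchors s h).powerset).filter (fun J : Finset (Finset (Fin h) × Finset (Fin h)) => nTails W J = q),
    (∏ α ∈ J, Θ α) * P2.xcE Φ U J * ycE Ψ W J

variable {Θ : Finset (Fin h) × Finset (Fin h) → ℂ} {Φ Ψ : Finset (Fin h) × Finset (Fin h) → Fin h → ℂ}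

/-- `aeval` at the point on a `θ`-variable. -/
theorem aeval_ptPoint_theta (α : Finset (Fin h) × Finset (Fin h)) :
    aeval (ptPoint Θ Φ Ψ) (X (Sum.inl α) : MvPolynomial (Param h) ℂ) = Polynomial.C (Θ α) := by
  rw [aeval_X]; rfl

/-- `aeval` at the point on a `φ`-variable. -/
theorem aeval_ptPoint_phi (α : Finset (Fin h) × Finset (Fin h)) (b : Fin h) :
    aeval (ptPoint Θ Φ Ψ) (X (Sum.inr (Sum.inl (α, b))) : MvPolynomial (Param h) ℂ) = Polynomial.C (Φ α b) := by
  rw [aeval_X]; rfl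

/-- `aeval` at the point on a `ψ`-variable: `Ψ α d · T`. -/
theorem aeval_ptPoint_psi (α : Finset (Fin h) × Finset (Fin h)) (d : Fin h) :
    aeval (ptPoint Θ Φ Ψ) (X (Sum.inr (Sum.inr (α, d))) : MvPolynomial (Param h) ℂ) = Polynomial.C (Ψ α d) * Polynomial.X := by
  rw [aeval_X]; rfl

/-- The `θ`-monomial of `J` evaluates to the constant `Θ^J`. -/
theorem aeval_thetaMon (J : Finset (Finset (Fin h) × Finset (Fin h))) :
    aeval (ptPoint Θ Φ Ψ) (AnchorSets.thetaMon J) = Polynomial.C (∏ α ∈ J, Θ α) := by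
  rw [AnchorSets.thetaMon, map_prod, Finset.prod_congr rfl (fun α _ => aeval_ptPoint_theta α), map_prod]

/-- The `x`-coefficient evaluates to the constant `P2.xcE`. -/
theorem aeval_xcoeff (U : Finset (Fin h)) (J : Finset (Finset (Fin h) × Finset (Fin h))) :
    aeval (ptPoint Θ Φ Ψ) (AnchorSets.xcoeff U J) = Polynomial.C (P2.xcE Φ U J) := by
  classical
  rw [AnchorSets.xcoeff_eq, P2.xcE]
  by_cases hc : (J : Set (Finset (Fin h) × Finset (Fin h))).PairwiseDisjoint Prod.fst ∧ AnchorSets.xFoot J ⊆ U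
  · rw [if_pos hc, if_pos hc, map_prod, map_prod]
    refine Finset.prod_congr rfl (fun b _ => ?_)
    rw [map_sum, map_sum]
    exact Finset.sum_congr rfl (fun α _ => aeval_ptPoint_phi α b)
  · rw [if_neg hc, if_neg hc, map_zero, map_zero]

/-- **The `y`-coefficient evaluates to `ycE · T^{nTails}`.** -/
theorem aeval_ycoeff (W : Finset (Fin h)) (J : Finset (Finset (Fin h) × Finset (Fin h))) :
    aeval (ptPoint Θ Φ Ψ) (AnchorSets.ycoeff W J) = Polynomial.C (ycE Ψ W J) * Polynomial.X ^ nTails W J := by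
  classical
  rw [AnchorSets.ycoeff_eq, ycE]
  by_cases hc : (J : Set (Finset (Fin h) × Finset (Fin h))).PairwiseDisjoint Prod.snd ∧ AnchorSets.yFoot J ⊆ W
  · rw [if_pos hc, if_pos hc, map_prod]
    have hz : ∀ d ∈ W \ AnchorSets.yFoot J,
        aeval (ptPoint Θ Φ Ψ) (∑ α ∈ J, (X (Sum.inr (Sum.inr (α, d))) : MvPolynomial (Param h) ℂ)) =
          Polynomial.C (∑ α ∈ J, Ψ α d) * Polynomial.X := by
      intro d _
      rw [map_sum, Finset.sum_congr rfl (fun α _ => aeval_ptPoint_psi α d), ← Finset.sum_mul, ← map_sum]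
    rw [Finset.prod_congr rfl hz, Finset.prod_mul_distrib, ← map_prod, Finset.prod_const, nTails]
  · rw [if_neg hc, if_neg hc, map_zero, map_zero, zero_mul]

/-- **The evaluated layout entry:** `Σ_J Θ^J · xcE U J · ycE W J · T^{nTails W J}`. -/
theorem aeval_ptPoint_entry (s : ℕ) (U W : Finset (Fin h)) :
    aeval (ptPoint Θ Φ Ψ) (coeff (pexpo U W) (symbolicWitness s h)) =
      ∑ J ∈ (anchors s h).powerset, Polynomial.C ((∏ α ∈ J, Θ α) * P2.xcE Φ U J * ycE Ψ W J) * Polynomial.X ^ nTails W J := by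
  rw [AnchorSets.coeff_symbolicWitness_eq_sum, map_sum]
  refine Finset.sum_congr rfl (fun J _ => ?_)
  rw [map_mul, map_mul, aeval_thetaMon, aeval_xcoeff, aeval_ycoeff, map_mul, map_mul]
  ring

/-- **Coefficient extraction:** the `T^q`-coefficient of the evaluated entry is the tail-graded dominant entry `ptEntry s q`. -/
theorem coeff_aeval_entry (s q : ℕ) (U W : Finset (Fin h)) :
    (aeval (ptPoint Θ Φ Ψ) (coeff (pexpo U W) (symbolicWitness s h))).coeff q = ptEntry s q Θ Φ Ψ W U := by
  classical
  rw [aeval_ptPoint_entry, Polynomial.finsetSum_coeff, ptEntry, Finset.sum_filter]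
  refine Finset.sum_congr rfl (fun J _ => ?_)
  rw [Polynomial.coeff_C_mul_X_pow]
  by_cases hq : nTails W J = q
  · rw [if_pos hq.symm, if_pos hq]
  · rw [if_neg (fun h' => hq h'.symm), if_neg hq]

end Point

/-! ## 3. Vanishing of the low tail counts -/

/-- A contributing anchor set has at most `|U|` anchors: its `x`-parts are non-empty, pairwise disjoint and inside `U`. -/
theorem card_le_of_xcE_ne_zero {Φ : Finset (Fin h) × Finset (Fin h) → Fin h → ℂ} {s : ℕ} {U : Finset (Fin h)}
    {J : Finset (Finset (Fin h) × Finset (Fin h))} (hJ : J ⊆ anchors s h) (hx : P2.xcE Φ U J ≠ 0) : J.card ≤ U.card := by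
  classical
  rw [P2.xcE] at hx
  by_cases hc : (J : Set (Finset (Fin h) × Finset (Fin h))).PairwiseDisjoint Prod.fst ∧ AnchorSets.xFoot J ⊆ U
  · have hne : ∀ α ∈ J, (α.1).Nonempty := by
      intro α hα
      have hmem := hJ hα
      simp only [anchors, Finset.mem_filter, Finset.mem_univ, true_and] at hmem
      exact Finset.card_pos.mp hmem.1
    calc J.card ≤ (J.biUnion Prod.fst).card := Finset.card_le_card_biUnion hc.1 hne
      _ ≤ U.card := Finset.card_le_card hc.2
  · exact absurd (if_neg hc) hx

/-- A contributing anchor set has `y`-footprint of size `≤ s |J|` inside `W`, hence at least `|W| − s|J|` tails. -/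
theorem card_le_nTails_of_ycE_ne_zero {Ψ : Finset (Fin h) × Finset (Fin h) → Fin h → ℂ} {s : ℕ} {W : Finset (Fin h)}
    {J : Finset (Finset (Fin h) × Finset (Fin h))} (hJ : J ⊆ anchors s h) (hy : ycE Ψ W J ≠ 0) : W.card ≤ nTails W J + s * J.card := by
  classical
  rw [ycE] at hy
  by_cases hc : (J : Set (Finset (Fin h) × Finset (Fin h))).PairwiseDisjoint Prod.snd ∧ AnchorSets.yFoot J ⊆ W
  · have hfoot : (AnchorSets.yFoot J).card ≤ s * J.card := by
      rw [AnchorSets.yFoot]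
      calc (J.biUnion Prod.snd).card ≤ ∑ α ∈ J, α.2.card := Finset.card_biUnion_le
        _ ≤ ∑ _α ∈ J, s := Finset.sum_le_sum (fun α hα => by
            have hmem := hJ hα
            simp only [anchors, Finset.mem_filter, Finset.mem_univ, true_and] at hmem
            exact hmem.2.2.2)
        _ = s * J.card := by rw [Finset.sum_const, smul_eq_mul, mul_comm]
    have hsplit : W.card = nTails W J + (AnchorSets.yFoot J).card := by
      rw [nTails, Finset.card_sdiff_add_card_eq_card hc.2]
    omega
  · exact absurd (if_neg hc) hy

/-- **No tail counts below `|W| − s|U|`:** `ptEntry s q W U = 0` whenever `q + s|U| < |W|`. -/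
theorem ptEntry_eq_zero_of_lt (Θ : Finset (Fin h) × Finset (Fin h) → ℂ) (Φ Ψ : Finset (Fin h) × Finset (Fin h) → Fin h → ℂ)
    {s q : ℕ} {W U : Finset (Fin h)} (hq : q + s * U.card < W.card) : ptEntry s q Θ Φ Ψ W U = 0 := by
  classical
  rw [ptEntry]
  refine Finset.sum_eq_zero (fun J hJ => ?_)
  obtain ⟨hJp, hJq⟩ := Finset.mem_filter.mp hJ
  have hJs : J ⊆ anchors s h := Finset.mem_powerset.mp hJp
  by_cases hx : P2.xcE Φ U J = 0
  · rw [hx, mul_zero, zero_mul]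
  by_cases hy : ycE Ψ W J = 0
  · rw [hy, mul_zero]
  exfalso
  have h1 := card_le_of_xcE_ne_zero hJs hx
  have h2 := card_le_nTails_of_ycE_ne_zero hJs hy
  rw [hJq] at h2
  have h3 : s * J.card ≤ s * U.card := Nat.mul_le_mul_left s h1
  omega

/-! ## 4. THE TAIL-GRADED REDUCTION K1′ -/

section Det

variable (Θ : Finset (Fin h) × Finset (Fin h) → ℂ) (Φ Ψ : Finset (Fin h) × Finset (Fin h) → Fin h → ℂ)

/-- **THE TAIL-GRADED (POTENTIAL-SHIFTED) REDUCTION, at every profile `s`.** Row potentials `a i ≥ 0` and column discounts `c j ≥ 0` (integer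
potentials `a i`, `−c j`) are ADMISSIBLE when `a i − c j + s |u i| ≤ |w j|` whenever `a i > c j` (no entry has a tail count below its potential).
If the tail-graded dominant matrix `N i j = [c j ≤ a i] · ptEntry s (a i − c j) Θ Φ Ψ (w j) (u i)` is nonsingular for some complex `Θ Φ Ψ`, then
`symbolicDet s h r u w ≠ 0`. (Proof: scale column `j` of the evaluated layout by `T^{c j}`; then no entry has a coefficient below `T^{a i}`, and the
coefficient of `T^{Σ a}` of the scaled determinant — a multiple of the evaluated symbolic minor — is `det N`, `coeff_det_of_potential`.) For the dual
potentials of a minimum-tail-count perfect matching, `N` is the matrix of bottom tail-graded entries on the tight edges. -/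
theorem symbolicDet_ne_zero_of_ptEntry {s r : ℕ} (u w : Fin r → Finset (Fin h)) (a c : Fin r → ℕ)
    (hac : ∀ i j, a i ≤ c j ∨ a i + s * (u i).card ≤ (w j).card + c j)
    (hdet : (Matrix.of fun i j : Fin r => if c j ≤ a i then ptEntry s (a i - c j) Θ Φ Ψ (w j) (u i) else 0).det ≠ 0) :
    symbolicDet s h r u w ≠ 0 := by
  classical
  intro h0
  set M : Matrix (Fin r) (Fin r) (Polynomial ℂ) :=
    Matrix.of fun i j : Fin r => aeval (ptPoint Θ Φ Ψ) (coeff (pexpo (u i) (w j)) (symbolicWitness s h)) with hM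
  have hmap : aeval (ptPoint Θ Φ Ψ) (symbolicDet s h r u w) = M.det := by
    rw [symbolicDet, AlgHom.map_det]
    congr 1
  have hMdet : M.det = 0 := by rw [← hmap, h0, map_zero]
  -- scale column `j` by `T^{c j}`
  set M' : Matrix (Fin r) (Fin r) (Polynomial ℂ) := Matrix.of fun i j : Fin r => Polynomial.X ^ c j * M i j with hM'
  have hM'eq : M' = M * Matrix.diagonal (fun j => Polynomial.X ^ c j) := by
    ext i j
    rw [hM', Matrix.of_apply, Matrix.mul_diagonal, mul_comm]
  have hM'det : M'.det = 0 := by rw [hM'eq, Matrix.det_mul, hMdet, zero_mul]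
  have hvan : ∀ i j, ∀ k < a i + (fun _ : Fin r => 0) j, (M' i j).coeff k = 0 := by
    intro i j k hk
    simp only [add_zero] at hk
    rw [hM', Matrix.of_apply, Polynomial.coeff_X_pow_mul']
    by_cases hkc : c j ≤ k
    · rw [if_pos hkc, hM, Matrix.of_apply, coeff_aeval_entry]
      refine ptEntry_eq_zero_of_lt Θ Φ Ψ ?_
      rcases hac i j with hle | hle
      · omega
      · omega
    · rw [if_neg hkc]
  have hbot := coeff_det_of_potential M' a (fun _ => 0) hvan
  rw [hM'det, Polynomial.coeff_zero] at hbot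
  have hmat : (Matrix.of fun i j : Fin r => (M' i j).coeff (a i + (fun _ : Fin r => 0) j)) =
      Matrix.of fun i j : Fin r => if c j ≤ a i then ptEntry s (a i - c j) Θ Φ Ψ (w j) (u i) else 0 := by
    ext i j
    rw [Matrix.of_apply, Matrix.of_apply, hM', Matrix.of_apply, add_zero, Polynomial.coeff_X_pow_mul']
    by_cases hca : c j ≤ a i
    · rw [if_pos hca, if_pos hca, hM, Matrix.of_apply, coeff_aeval_entry]
    · rw [if_neg hca, if_neg hca]
  exact hdet (by rw [← hmat, ← hbot])

/-- **Non-negative potentials** (`c = 0`): admissible when `a i + b j + s|u i| ≤ |w j|` or `a i + b j = 0`; here stated with row potentials only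
absorbed into `a` and column potentials `b` — the dominant matrix is `ptEntry s (a i + b j)`. -/
theorem symbolicDet_ne_zero_of_ptEntry_nonneg {s r : ℕ} (u w : Fin r → Finset (Fin h)) (a b : Fin r → ℕ)
    (hab : ∀ i j, a i + b j = 0 ∨ a i + b j + s * (u i).card ≤ (w j).card)
    (hdet : (Matrix.of fun i j : Fin r => ptEntry s (a i + b j) Θ Φ Ψ (w j) (u i)).det ≠ 0) : symbolicDet s h r u w ≠ 0 := by
  classical
  intro h0
  set M : Matrix (Fin r) (Fin r) (Polynomial ℂ) :=
    Matrix.of fun i j : Fin r => aeval (ptPoint Θ Φ Ψ) (coeff (pexpo (u i) (w j)) (symbolicWitness s h)) with hM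
  have hmap : aeval (ptPoint Θ Φ Ψ) (symbolicDet s h r u w) = M.det := by
    rw [symbolicDet, AlgHom.map_det]
    congr 1
  have hMdet : M.det = 0 := by rw [← hmap, h0, map_zero]
  have hvan : ∀ i j, ∀ k < a i + b j, (M i j).coeff k = 0 := by
    intro i j k hk
    rw [hM, Matrix.of_apply, coeff_aeval_entry]
    refine ptEntry_eq_zero_of_lt Θ Φ Ψ ?_
    rcases hab i j with hz | hle
    · omega
    · omega
  have hbot := coeff_det_of_potential M a b hvan
  rw [hMdet, Polynomial.coeff_zero] at hbot
  have hmat : (Matrix.of fun i j : Fin r => (M i j).coeff (a i + b j)) =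
      Matrix.of fun i j : Fin r => ptEntry s (a i + b j) Θ Φ Ψ (w j) (u i) := by
    ext i j
    rw [Matrix.of_apply, Matrix.of_apply, hM, Matrix.of_apply, coeff_aeval_entry]
  exact hdet (by rw [← hmat, ← hbot])

/-- **The tail-free case `a = c = 0`:** nonsingularity of `(ptEntry s 0 Θ Φ Ψ (w j) (u i))` (the dominant problem without `y`-tails: all anchor
sets whose `y`-parts partition the column) gives `symbolicDet s h r u w ≠ 0`. -/
theorem symbolicDet_ne_zero_of_ptEntry_zero {s r : ℕ} (u w : Fin r → Finset (Fin h))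
    (hdet : (Matrix.of fun i j : Fin r => ptEntry s 0 Θ Φ Ψ (w j) (u i)).det ≠ 0) : symbolicDet s h r u w ≠ 0 :=
  symbolicDet_ne_zero_of_ptEntry_nonneg Θ Φ Ψ u w (fun _ => 0) (fun _ => 0) (fun _ _ => Or.inl rfl) (by simpa using hdet)

end Det

end PT

end

end Summit.ValiantsHypothesis.ValiantsHypothesis.Theorems.BarrierLever.AnchoredPeeling
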